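import Summits.CriticalPhenomena.CardyFormulaZ2.Theorems.CardyMagicRigidityNestingRigidityOneGenerationZ2
import HarnessLib

/-!
# The one-generation factorisation on `ℤ²`, functional form

Crux `Summit.CriticalPhenomena.CardyFormulaZ2.Theses.CardyMagicRigidity.NestingRigidity`
(stmt-CriticalPhenomena-4835), line `markov-cascade-one-generation`, registered helper
`oneGenerationZ2_integral_mul` (wave 2, toward `stub_deAveraging` / `stub_cascadeReconstruction`):
the one-generation factorisation `stub_oneGenerationZ2` (`…OneGenerationZ2.lean`) with a bounded
measurable FUNCTION `H` of the outside edges in place of an outside EVENT: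
for `δ > 0`, `f` carried by the winding interior of the drawn circuit `loopCurve δ 0 γ` with
`∫ f = 0`,
`E[A_f · H(ω_out) ; I_γ] = M_γ(f) · E[H(ω_out) ; I_γ]`,
where `ω_out = ω ∩ outsideEdges γ`, `I_γ = {IsInterfaceLoop · γ}`,
`A_f = nestingWeight f ∘ bondLoopConfig δ 0` and `M_γ = condTransformZ2`.

Proof (Camia–Newman CMP 268 §2, domain-Markov property of the product measure, redone with
functions).  On `I_γ`, `A_f = N := ∏ᶠ_{inside loops}` (`nestingWeight_eq_finprod_inside`), and
`1_{I_γ} · N`, `1_{I_γ}` are determined by the coordinates in the finite set `F` of local edges of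
`γ` (`isInterfaceLoop_iff_of_inter_eq`, `insideLoopsZ2_subset_of_inter_eq`), hence measurable for
the coordinate σ-algebra `𝓕[F]` (`measurable_coord_of_determined_finite`); `K := H(ω_out)` is
`𝓕[outsideEdges γ]`-measurable (`measurable_inter_coord`); `F` misses `outsideEdges γ`
(`disjoint_localEdges_outsideEdges`), so the two σ-algebras are independent (`indep_coord`) and
`E[1_I N · K] = E[1_I N] E[K]`, `E[1_I · K] = P(I) E[K]`
(`IndepFun.integral_fun_mul_eq_mul_integral`, no integrability needed); divide by `P(I)` (both
sides vanish when `P(I) = 0` or `γ` is never an interface loop).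
-/

noncomputable section

open MeasureTheory ProbabilityTheory Set Filter Function
open scoped Topology BigOperators ENNReal Real

namespace Summit.CriticalPhenomena.CardyFormulaZ2.Cruxes.NestingRigidity.MarkovCascadeOneGeneration

open Literature.Probability.RandomPlanarGeometry Literature.Probability.Percolation
  Literature.Probability.LatticeModels
open Summit.CriticalPhenomena.CardyFormulaZ2.Theses.CardyMagicRigidity

/-- **Product formula for two local functions** of disjoint families of coordinates under bond
percolation: `E[g · k] = E[g] · E[k]` for `g` `𝓕[S]`-measurable and `k` `𝓕[T]`-measurable,
`S ∩ T = ∅` (no integrability needed). -/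
theorem integral_mul_of_coord {V : Type*} [Countable V] (G : SimpleGraph V) (p : unitInterval)
    {S T : Set (Sym2 V)} (hST : Disjoint S T) {g k : BondConfig V → ℝ}
    (hg : Measurable[⨆ e ∈ S, MeasurableSpace.comap (fun ω : BondConfig V ↦ e ∈ ω)
      inferInstance] g)
    (hk : Measurable[⨆ e ∈ T, MeasurableSpace.comap (fun ω : BondConfig V ↦ e ∈ ω)
      inferInstance] k) :
    ∫ ω, g ω * k ω ∂(bondPercolation G p) =
      (∫ ω, g ω ∂(bondPercolation G p)) * ∫ ω, k ω ∂(bondPercolation G p) := by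
  have hind : IndepFun g k (bondPercolation G p) := by
    rw [IndepFun_iff_Indep]
    exact indep_of_indep_of_le_right (indep_of_indep_of_le_left (indep_coord G p hST)
      hg.comap_le) hk.comap_le
  exact hind.integral_fun_mul_eq_mul_integral (hg.mono (coord_le S) le_rfl).aestronglyMeasurable
    (hk.mono (coord_le T) le_rfl).aestronglyMeasurable

/-- A function of the restriction `ω ∩ T` is `𝓕[T]`-measurable when the outer function is
measurable. -/
theorem measurable_comp_inter_coord {V : Type*} {β : Type*} [MeasurableSpace β]
    {H : BondConfig V → β} (hH : Measurable H) (T : Set (Sym2 V)) :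
    Measurable[⨆ e ∈ T, MeasurableSpace.comap (fun ω : BondConfig V ↦ e ∈ ω) inferInstance]
      fun ω ↦ H (ω ∩ T) :=
  hH.comp (measurable_inter_coord T)

/-- **Registered helper `oneGenerationZ2_integral_mul`: the one-generation factorisation on `ℤ²`
in functional form.** For `δ > 0`, a medial circuit `γ`, a test density `f` carried by the
winding interior of `loopCurve δ 0 γ` with `∫ f = 0`, and a bounded measurable function `H` of
the configuration restricted to the edges strictly outside `γ`,
`E[A_f · H(ω ∩ outsideEdges γ) ; I_γ] = M_γ(f) · E[H(ω ∩ outsideEdges γ) ; I_γ]` under `P2`. -/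
theorem oneGenerationZ2_integral_mul : ∀ (δ : ℝ) (γ : List MedialVertex) (f : ℂ → ℝ) (H : Set MedialVertex → ℝ), 0 < δ → (∀ z, f z ≠ 0 → (loopCurve δ 0 γ).wind z ≠ 0) → ∫ z, f z = 0 → Measurable H → (∃ C : ℝ, ∀ s, |H s| ≤ C) → ∫ ω in {ω | IsInterfaceLoop ω γ}, (bondLoopConfig δ 0 ω).nestingWeight f * H (ω ∩ outsideEdges γ) ∂P2 = condTransformZ2 δ γ f * ∫ ω in {ω | IsInterfaceLoop ω γ}, H (ω ∩ outsideEdges γ) ∂P2 := by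
  intro δ γ f H hδ hf hf0 hHm _
  set I : Set (BondConfig (Site 2)) := {ω | IsInterfaceLoop ω γ}
  set N : BondConfig (Site 2) → ℝ := fun ω ↦ ∏ᶠ u ∈ insideLoopsZ2 δ γ ω, u.nestingFactor f with hN
  have hIm : MeasurableSet I := measurableSet_setOf.2 (measurable_isInterfaceLoop γ)
  -- degenerate case: `γ` is an interface loop of no configuration
  by_cases hex : ∃ ω₀, IsInterfaceLoop ω₀ γ
  swap
  · have hI0 : I = ∅ := eq_empty_of_forall_notMem fun ω hω ↦ hex ⟨ω, hω⟩
    simp [hI0]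
  obtain ⟨ω₀, h₀⟩ := hex
  -- the local edges of `γ`
  set F : Set MedialVertex := {e | e ∈ γ} ∪ cSrc '' {p : Site 2 × Fin 4 |
    (loopCurve 1 0 γ).wind (meshPoint 1 p.1) ≠ 0 ∨
      (loopCurve 1 0 γ).wind (faceCenter (cFace p)) ≠ 0}
  have hFfin : F.Finite := finite_localEdges γ
  have hFout : Disjoint F (outsideEdges γ) := disjoint_localEdges_outsideEdges h₀
  -- `1_I · N` and `1_I` are determined by the coordinates in `F`
  have hΦ : ∀ ω ω' : BondConfig (Site 2), ω ∩ F = ω' ∩ F → I.indicator N ω = I.indicator N ω' := by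
    intro ω ω' hωω'
    have hiff : IsInterfaceLoop ω γ ↔ IsInterfaceLoop ω' γ := isInterfaceLoop_iff_of_inter_eq hωω'
    by_cases hω : ω ∈ I
    · rw [indicator_of_mem hω, indicator_of_mem (show ω' ∈ I from hiff.1 hω)]
      simp only [hN, Subset.antisymm (insideLoopsZ2_subset_of_inter_eq hδ.ne' hωω')
        (insideLoopsZ2_subset_of_inter_eq hδ.ne' hωω'.symm)]
    · rw [indicator_of_notMem hω, indicator_of_notMem (show ω' ∉ I from fun h ↦ hω (hiff.2 h))]
  have h1 : ∀ ω ω' : BondConfig (Site 2), ω ∩ F = ω' ∩ F →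
      I.indicator (1 : BondConfig (Site 2) → ℝ) ω = I.indicator 1 ω' := by
    intro ω ω' hωω'
    have hiff : IsInterfaceLoop ω γ ↔ IsInterfaceLoop ω' γ := isInterfaceLoop_iff_of_inter_eq hωω'
    by_cases hω : ω ∈ I
    · simp only [indicator_of_mem hω, indicator_of_mem (show ω' ∈ I from hiff.1 hω), Pi.one_apply]
    · rw [indicator_of_notMem hω, indicator_of_notMem (show ω' ∉ I from fun h ↦ hω (hiff.2 h))]
  have hKm := measurable_comp_inter_coord hHm (outsideEdges γ)
  -- product structure
  have eqN : ∫ ω, I.indicator N ω * H (ω ∩ outsideEdges γ) ∂P2 =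
      (∫ ω, I.indicator N ω ∂P2) * ∫ ω, H (ω ∩ outsideEdges γ) ∂P2 :=
    integral_mul_of_coord (zdGraph 2) half hFout (measurable_coord_of_determined_finite hFfin hΦ)
      hKm
  have eq1 : ∫ ω, I.indicator (1 : BondConfig (Site 2) → ℝ) ω * H (ω ∩ outsideEdges γ) ∂P2 =
      (∫ ω, I.indicator (1 : BondConfig (Site 2) → ℝ) ω ∂P2) * ∫ ω, H (ω ∩ outsideEdges γ) ∂P2 :=
    integral_mul_of_coord (zdGraph 2) half hFout (measurable_coord_of_determined_finite hFfin h1)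
      hKm
  -- Step 1, pointwise: `1_I · (A_f · K) = (1_I · N) · K`
  have hpt : I.indicator (fun ω ↦ (bondLoopConfig δ 0 ω).nestingWeight f *
      H (ω ∩ outsideEdges γ)) = fun ω ↦ I.indicator N ω * H (ω ∩ outsideEdges γ) := by
    funext ω
    by_cases hωI : ω ∈ I
    · rw [indicator_of_mem hωI, indicator_of_mem hωI]
      exact congrArg (· * H (ω ∩ outsideEdges γ)) (nestingWeight_eq_finprod_inside hδ hωI hf hf0)
    · rw [indicator_of_notMem hωI, indicator_of_notMem hωI, zero_mul]
  have hpt1 : I.indicator (fun ω ↦ H (ω ∩ outsideEdges γ)) =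
      fun ω ↦ I.indicator (1 : BondConfig (Site 2) → ℝ) ω * H (ω ∩ outsideEdges γ) := by
    funext ω
    by_cases hωI : ω ∈ I
    · rw [indicator_of_mem hωI, indicator_of_mem hωI, Pi.one_apply, one_mul]
    · rw [indicator_of_notMem hωI, indicator_of_notMem hωI, zero_mul]
  have hLHS : ∫ ω in I, (bondLoopConfig δ 0 ω).nestingWeight f * H (ω ∩ outsideEdges γ) ∂P2 =
      (∫ ω, I.indicator N ω ∂P2) * ∫ ω, H (ω ∩ outsideEdges γ) ∂P2 := by
    rw [← integral_indicator hIm, hpt, eqN]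
  have hRHS : ∫ ω in I, H (ω ∩ outsideEdges γ) ∂P2 =
      P2.real I * ∫ ω, H (ω ∩ outsideEdges γ) ∂P2 := by
    rw [← integral_indicator hIm, hpt1, eq1, integral_indicator_one hIm]
  have hcond : condTransformZ2 δ γ f = (∫ ω, I.indicator N ω ∂P2) / P2.real I := by
    rw [condTransformZ2, integral_indicator hIm, measureReal_def]
  rw [hLHS, hRHS, hcond]
  by_cases hI0 : P2.real I = 0
  · have hint : ∫ ω, I.indicator N ω ∂P2 = 0 := by
      rw [integral_indicator hIm]
      exact setIntegral_measure_zero _ ((measureReal_eq_zero_iff (measure_ne_top P2 I)).1 hI0)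
    simp [hint]
  · field_simp

end Summit.CriticalPhenomena.CardyFormulaZ2.Cruxes.NestingRigidity.MarkovCascadeOneGeneration

end
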